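import Literature.AlgebraicGeometry.Frobenioids.PadicKummerSaturatedPullback
import Literature.AlgebraicGeometry.Frobenioids.PadicKummerRemark221Tri
import HarnessLib

/-!
# Frobenioids II, Remark 2.2.1 / Definition 2.3: cofinal saturated objects with all of §2's hypotheses

Mochizuki, *The geometry of Frobenioids II*, Kyushu J. Math. **62** (2008) 401–460, §2, Remark 2.2.1
p. 18 and Definition 2.3 p. 19 [cite: MochizukiFrdII2008, Rmk 2.2.1 p.18]: "there exists a pull-back
morphism `A″ → A′` in `C` such that `A″` is `(N, H)`-saturated. In the notation of Definition 2.2,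
suppose that `A` is `(N,H)`-saturated. Write `A_E = Spec(L)` … we have a natural isomorphism
`(O^□(A) ⊇) O^□(A)^H ⥲ O^□(L^H)` … any element `f ∈ O^□(A)^H` admits an `N`-th root `g ∈ O^□(A)` …
Thus, the Kummer map [cf. Definition 2.1, (ii)] is defined on all of `O^□(A)^H`."

Proof-only sequel of `PadicKummerSaturatedPullback.lean` (abc-iut-L1-t7): the saturated pull-backs
produced there can be taken COFINAL in the printed sense — `L″ ⊇ L′ · K̄^H`, i.e. `Gal(K̄/L″) ≤ H`,
so that `H_A = Gal(L″/K̄^H)` and `Ker(H ↠ H_A) = Gal(K̄/L″)` — which is the situation in which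
abc-iut-L1-t7's discharges of the OTHER standing hypotheses of Definitions 2.2–2.3 apply. Hence,
above every `A′` and for every `N ≥ 1`, `H`, there is an object `A″` for which SIMULTANEOUSLY:
`A″` is `(N, H)`-saturated (Def. 2.2 (ii)), "any element `f ∈ O^□(A″)^H` admits an `N`-th root"
(`Kummer.InvariantsAdmitRoots`, Rmk. 2.2.1 — `saturatedInvariantsAdmitRoots_ofLocalField_box`),
the torsor property of `N`-th roots (`Kummer.NthRootsDifferByUnits`, [FrdI] Def. 1.3 (vi) — here
`GalMonoid.nthRootsDifferByUnits`, elementary in a field), and "`F_N(A″) ≅ ℤ/Nℤ`"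
(`nonempty_fn_equiv_zmod_ofLocalField`, NSW 7.2.6): the Kummer map and the reciprocity map of
Definition 2.3 (`Kummer.kummerMapOfRoots`, `Kummer.reciprocityMap`) are thus defined on all of
`O^□(A″)^H` for a cofinal system of objects, given the duality datum `Kummer.DualityIso` (local Tate
duality; constructed by the L4/L2 seats). Results: `GalMonoid.nthRootsDifferByUnits`,
`exists_isNHSaturated_ofLocalField_le`, `exists_saturated_kummerHypotheses_ofLocalField`.
No definitions; nothing here concerns [IUTchIII]; classical. Universe `0`.
-/

noncomputable section

namespace Literature.AlgebraicGeometry.Frobenioids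

namespace PadicKummer

open Field IntermediateField
open Literature.NumberTheory.GaloisRepresentations
open Literature.NumberTheory.GaloisRepresentations.LocalWeilDatum

/-! ### The torsor property of `N`-th roots in `O^□_L` -/

/-- **[FrdI] Def. 1.3 (vi) / [FrdII] Def. 2.1 (ii) at the arithmetic monoid**: in a `Gal(L/K)`-stable
submonoid `O^□_L ⊆ L` containing the `N`-th roots of unity of `L`, two `N`-th roots of the same
element differ by a unit (their quotient is an `N`-th root of unity) — `Kummer.NthRootsDifferByUnits`.
[cite: MochizukiFrdII2008, Def 2.1 (ii) p.16] -/
theorem GalMonoid.nthRootsDifferByUnits {K : Type} [Field K]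
    {L : IntermediateField K (AlgebraicClosure K)} (S : StableSubmonoid L) (N : ℕ)
    (hS : ∀ x : L, x ^ N = 1 → x ∈ S.toSubmonoid) :
    Kummer.NthRootsDifferByUnits N (GalMonoid S) := by
  refine ⟨fun g g' h => ?_⟩
  have hg : g.val ≠ 0 := GalMonoid.val_ne_zero g
  have hg' : g'.val ≠ 0 := GalMonoid.val_ne_zero g'
  have hN : g'.val ^ N = g.val ^ N := by
    rw [← GalMonoid.val_pow, ← GalMonoid.val_pow, h]
  have hu : (g'.val / g.val) ^ N = 1 := by
    rw [div_pow, hN, div_self (pow_ne_zero N hg)]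
  have hu' : (g.val / g'.val) ^ N = 1 := by
    rw [div_pow, ← hN, div_self (pow_ne_zero N hg')]
  refine ⟨⟨GalMonoid.mk _ (hS _ hu), GalMonoid.mk _ (hS _ hu'), GalMonoid.ext ?_, GalMonoid.ext ?_⟩,
    GalMonoid.ext ?_⟩
  · rw [GalMonoid.val_mul, GalMonoid.val_mk, GalMonoid.val_mk, GalMonoid.val_one,
      div_mul_div_cancel₀ hg, div_self hg']
  · rw [GalMonoid.val_mul, GalMonoid.val_mk, GalMonoid.val_mk, GalMonoid.val_one,
      div_mul_div_cancel₀ hg', div_self hg]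
  · change g'.val = (g'.val / g.val) * g.val
    rw [div_mul_cancel₀ _ hg]

namespace Def22Context

variable {K : Type} [Field K] [ValuativeRel K] [TopologicalSpace K] [IsNonarchimedeanLocalField K]
  [CharZero K]

/-- **Remark 2.2.1, cofinal form** (FrdII p. 18): the `(N, H)`-saturated `A″ → A′` of
`exists_isNHSaturated_ofLocalField` can be chosen with `L″ ⊇ K̄^H` as well, i.e. `Gal(K̄/L″) ≤ H`
(apply the existence theorem to `L′ · K̄^H`; `K̄^H` is the finite Galois extension with group `H`,
`exists_galFixing_eq`), so that `H_A = Gal(L″/K̄^H)` and `Ker(H ↠ H_A) = Gal(K̄/L″)`.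
[cite: MochizukiFrdII2008, Rmk 2.2.1 p.18] -/
theorem exists_isNHSaturated_ofLocalField_le (L' : IntermediateField K (AlgebraicClosure K))
    [FiniteDimensional K L'] (H : Subgroup (absoluteGaloisGroup K)) [H.Normal]
    (hH : IsOpen (H : Set (absoluteGaloisGroup K))) (N : ℕ) [NeZero N] :
    ∃ L : IntermediateField K (AlgebraicClosure K), ∃ (_ : FiniteDimensional K L)
      (_ : IsGalois K L), L' ≤ L ∧ galFixing K L ≤ H ∧ ∀ S : StableSubmonoid L,
        (∀ x : L, x ^ N = 1 → x ∈ S.toSubmonoid) → IsNHSaturated (ofLocalField L H hH S) N := by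
  obtain ⟨E₀, hE₀fin, _, hE₀⟩ := exists_galFixing_eq H hH
  haveI := hE₀fin
  obtain ⟨L, hfin, hgal, hle, hsat⟩ := exists_isNHSaturated_ofLocalField (L' ⊔ E₀) H hH N
  refine ⟨L, hfin, hgal, le_sup_left.trans hle, ?_, hsat⟩
  rw [← hE₀]
  exact galFixing_antitone K (le_sup_right.trans hle)

/-- **Remark 2.2.1 + Definition 2.3: all standing hypotheses at once, cofinally** (FrdII pp. 18–19):
for `K` a non-archimedean local field of characteristic `0`, above every finite `L′ ⊆ K̄` and for
every `N ≥ 1`, every open normal `H ⊆ G_K` and either choice of `O^□` (Def. 2.2 (iii), `fs`), there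
is a finite Galois `L″ ⊇ L′` with `Gal(K̄/L″) ≤ H` such that for `A″ = (L″, O^□_{L″})`:
`A″` is `(N, H)`-saturated; every `f ∈ O^□(A″)^H` admits an `N`-th root in `O^□(A″)`
(`Kummer.InvariantsAdmitRoots`); `N`-th roots differ by units (`Kummer.NthRootsDifferByUnits`);
and `F_N(A″) ≅ ℤ/Nℤ` — so "the Kummer map … is defined on all of `O^□(A)^H`"
(`Kummer.kummerMapOfRoots`) and so is the reciprocity map, given the duality isomorphism.
[cite: MochizukiFrdII2008, Def 2.3 p.19] -/
theorem exists_saturated_kummerHypotheses_ofLocalField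
    (L' : IntermediateField K (AlgebraicClosure K)) [FiniteDimensional K L']
    (H : Subgroup (absoluteGaloisGroup K)) [H.Normal]
    (hH : IsOpen (H : Set (absoluteGaloisGroup K))) (N : ℕ) [NeZero N] (fs : Prop) :
    ∃ L : IntermediateField K (AlgebraicClosure K), ∃ (_ : FiniteDimensional K L)
      (_ : IsGalois K L), L' ≤ L ∧ galFixing K L ≤ H ∧
        IsNHSaturated (ofLocalField L H hH (boxStableSubmonoid K L fs)) N ∧
        Kummer.InvariantsAdmitRoots N (GalMonoid (boxStableSubmonoid K L fs))
          (ofLocalField L H hH (boxStableSubmonoid K L fs)).HA ∧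
        Kummer.NthRootsDifferByUnits N (GalMonoid (boxStableSubmonoid K L fs)) ∧
        Nonempty (FN (ofLocalField L H hH (boxStableSubmonoid K L fs)) N ≃+ ZMod N) := by
  obtain ⟨L, hfin, hgal, hle, hHL, hsat⟩ := exists_isNHSaturated_ofLocalField_le L' H hH N
  haveI := hfin
  haveI := hgal
  have hS : ∀ x : L, x ^ N = 1 → x ∈ (boxStableSubmonoid K L fs).toSubmonoid := fun x hx =>
    mem_boxStableSubmonoid_of_pow_eq_one K L N fs (NeZero.pos N) hx
  have h := hsat (boxStableSubmonoid K L fs) hS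
  have hμ := coe_rootsOfUnity_mem_of_isMuSaturated L (boxStableSubmonoid K L fs) N h.muSaturated
  exact ⟨L, hfin, hgal, hle, hHL, h,
    saturatedInvariantsAdmitRoots_ofLocalField_box L N H hH fs hHL h,
    GalMonoid.nthRootsDifferByUnits (boxStableSubmonoid K L fs) N hS,
    nonempty_fn_equiv_zmod_ofLocalField L H hH (boxStableSubmonoid K L fs) N hS hμ h⟩

end Def22Context

end PadicKummer

end Literature.AlgebraicGeometry.Frobenioids

end
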